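import Summits.QuantumFields.BalabanUV.T4Continuum.Support.B13OutKPForm
import Summits.QuantumFields.BalabanUV.T4Continuum.Support.B13StepOfRecord

/-!
# NE5 ∕ U3, route P2 — R-IDENT part (D): ON THE OBJECTS OF RECORD — route P2's functionals `EAre`∕`EBre` over
# `B13DomainGeometryTR.domainGeometry R` ARE the holder lineage's outputs of record `B13StepOfRecord.outA`∕`outB` wherever the
# convergence binders hold; hence NE5 transfers between the two routes' functionals on a window

Cell `pub-balaban`, unit `b2b-balaban-t4-ne5-p2` (T⁴ fan-out NE5 ∕ node U3, PROVER seat P2 «polymer-activity Lipschitz ∕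
Kotecký–Preiss route», lineage gen 18; journal CLAIM «R-IDENT»).  Summits-side new work under the LEAN PLACEMENT RULE (cell
bookkeeping over the swarm's objects of record; NOT a Literature module; nothing of the manuscripts under audit is asserted).
HONEST FRAMING: rung (B)+1 of the FINITE-VOLUME T⁴ continuum programme — NOT infinite volume, NOT a mass gap, NOT the Clay problem,
NOT a proof of NE5 (spine 0∕9).  HONEST DEPENDENCY (cell line, verbatim): continuum YM on T⁴ ⇐ BetaPertH ∧ nine spine estimates
(0/9 proved); BetaPertH ⇐ (D1) ∧ (D4) ∧ CAP+tail; G-an2-4 gates asym, D1 and NE2/3/4.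

WHAT.  For the slots `S : B13StepOfRecord.Slots R E IOp Hist` of the model of record (its (2.14)-terms `S.act`, species, insertion
datum — NAMED PARAMETERS), levels `E₀`, `cB`, and activity families `ρA ρB` of route P2's cluster representation
`B13DomainGeometryTR.clusterRep R ρA ρB` on the SAME carriers∕geometry of record:
* `inputB`∕`inputA` — the two runs' input points of record at `(g, U, X)` (the step model's operator datum and inserted history,
  the history table being the run's own output of record: `StepRecursion`'s causal recursion, rows O1-c∕O1-e);
* **`EBre_eq_outB`** ∕ **`EAre_eq_outA`**: if `ρB g U` (resp. `ρA g U`) READS the activity `H Z = Σ_ℓ S.act Z ℓ o h` at run B's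
  (resp. run A's, transported) input point of record on the step catalogue of `X`, then under part (C)'s two convergence binders at
  that point route P2's functional `(domainGeometry R).EBre ρA ρB g U X` (L01 BY DEFINITION, `represents_re`) EQUALS the holder
  lineage's `B13StepOfRecord.outB S E₀ cB g U X` (L02 by the recursion, `representsB`) — part (C) `EBre_eq_re_out` + `step_Out`
  (`rfl`) + `representsB`; run A the same under the holder's transport reading `TransportReads`;
* **`ne5_congr`** (NE5 only reads the functionals on `W × BgB × Dom`) and **`ne5_record_of_ne5_re`** ∕ **`ne5_re_of_ne5_record`**:
  on a window where the two pairs of functionals agree, `T4OutputRate.NE5` for route P2's `(EAre, EBre)` and for the outputs of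
  record `(outA, outB)` are EQUIVALENT — the two NE5 routes prove the SAME statement about the SAME functionals.
No estimate; the convergence binders and the activity readings are displayed hypotheses (dischargeable from the swarm's anchored
activity norm by part (C) §4).  `FlowStep.BetaPertH`, (B), (B^μ) do not occur.  0 sorry; axioms ⊆ {propext, Classical.choice,
Quot.sound}.
-/

noncomputable section

open scoped BigOperators

namespace Summit.QuantumFields.BalabanUV.T4Continuum.B13OutKPFormRecord

open Literature.MathematicalPhysics.QuantumFieldTheory.Balaban1983to89
open Literature.MathematicalPhysics.QuantumFieldTheory.Balaban1983to89.T4OutputRate (Carriers Functional NE5)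
open Literature.MathematicalPhysics.QuantumFieldTheory.Balaban1983to89.T4InputCauchyRateData (StepModel tableA tableB)
open Literature.Probability.LatticeModels (truncatedWeight)
open Summit.QuantumFields.BalabanUV.T4Continuum.B13Carriers (TwoRuns)
open Summit.QuantumFields.BalabanUV.T4Continuum.ClusterRepOfDomains (DomainGeometry)
open Summit.QuantumFields.BalabanUV.T4Continuum.B13DomainGeometryTR (domainGeometry)
open Summit.QuantumFields.BalabanUV.T4Continuum.B13InnerData (b13InnerData Bnd)
open Summit.QuantumFields.BalabanUV.T4Continuum.B13OpDatum (OpDatum)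
open Summit.QuantumFields.BalabanUV.T4Continuum.B13StepOfRecord (Slots step outA outB assembly step_Out representsB representsA)
open Summit.QuantumFields.BalabanUV.T4Continuum.B13StepTermLabels (InnerLabel termLabels)
open Summit.QuantumFields.BalabanUV.T4Continuum.B13StepTermSocket (touchInc labelsIndexing)
open Summit.QuantumFields.BalabanUV.T4Continuum.B13StepTermFamily (term out)
open Summit.QuantumFields.BalabanUV.T4Continuum.B13OutKPForm (activity EBre_eq_re_out outA_clusterRep_eq_out outB_clusterRep_eq_out)
open Summit.QuantumFields.BalabanUV.T4Continuum.UrsellMayerSeries (UKabs)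

/-! ## §1 NE5 reads the functionals only on the window -/

/-- [folklore] **NE5 IS A STATEMENT ABOUT THE VALUES ON `W × BgB × Dom`**: two pairs of functionals agreeing there (run A at
transported backgrounds) satisfy the same `NE5`. -/
theorem ne5_congr {C : Carriers} {EA EA' : Functional C C.BgA} {EB EB' : Functional C C.BgB} {W : Set (ℕ → ℝ)} {κ θ C₅ : ℝ}
    (hA : ∀ g ∈ W, ∀ (U : C.BgB) (X : C.Dom), EA' g (C.transport U) X = EA g (C.transport U) X)
    (hB : ∀ g ∈ W, ∀ (U : C.BgB) (X : C.Dom), EB' g U X = EB g U X) (h : NE5 EA EB W κ θ C₅) : NE5 EA' EB' W κ θ C₅ := by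
  intro g hg U X
  rw [hA g hg U X, hB g hg U X]
  exact h g hg U X

/-- [folklore] Equivalence form of `ne5_congr`. -/
theorem ne5_iff_of_agree {C : Carriers} {EA EA' : Functional C C.BgA} {EB EB' : Functional C C.BgB} {W : Set (ℕ → ℝ)}
    {κ θ C₅ : ℝ} (hA : ∀ g ∈ W, ∀ (U : C.BgB) (X : C.Dom), EA' g (C.transport U) X = EA g (C.transport U) X)
    (hB : ∀ g ∈ W, ∀ (U : C.BgB) (X : C.Dom), EB' g U X = EB g U X) : NE5 EA EB W κ θ C₅ ↔ NE5 EA' EB' W κ θ C₅ :=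
  ⟨ne5_congr hA hB, ne5_congr (fun g hg U X => (hA g hg U X).symm) fun g hg U X => (hB g hg U X).symm⟩

/-! ## §2 The input points of record and the identification of the functionals -/

section Record

variable {G : Type} [GaugeGroup G] {R : TwoRuns G} {E IOp Hist : Type*} [NormedAddCommGroup Hist] [NormedSpace ℂ Hist]
  (S : Slots R E IOp Hist) (E₀ cB : ℝ) (ρA ρB : (ℕ → ℝ) → R.carriers.BgB → R.carriers.Dom → ℂ)

/-- [folklore] RUN B's INPUT POINT OF RECORD at `(g, U, X)`: the step model's run-B operator datum and inserted history at the step of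
`X`, the history table being run B's own output of record (rows O1-b∕c∕e). -/
def inputB (g : ℕ → ℝ) (U : R.carriers.BgB) (X : R.carriers.Dom) : OpDatum E × Hist :=
  ((step S E₀ cB).opB g U (R.carriers.scale X),
    (step S E₀ cB).insB g U (R.carriers.scale X) (tableB (outB S E₀ cB) g U))

/-- [folklore] RUN A's INPUT POINT OF RECORD at `(g, U, X)` (operator datum read at the transported background, run A's insertion of
its own output table). -/
def inputA (g : ℕ → ℝ) (U : R.carriers.BgB) (X : R.carriers.Dom) : OpDatum E × Hist :=
  ((step S E₀ cB).opA g U (R.carriers.scale X),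
    (step S E₀ cB).insA g U (R.carriers.scale X) (tableA (outA S E₀ cB) g U))

/-- [folklore] THE ACTIVITY OF RECORD at an input `(o, h)` on the step catalogue of `X`: `H Z = Σ_{ℓ ∈ innerLabels k Z} S.act Z ℓ o h`. -/
def actOf (X : R.carriers.Dom) (q : OpDatum E × Hist) : R.carriers.Dom → ℂ :=
  activity (b13InnerData R) S.act (R.carriers.scale X) q.1 q.2

/-- [folklore] BINDER (i) of part (C) at the input `q` of `X`: the socket's levelwise summability of the terms of record. -/
def LevelSummable (X : R.carriers.Dom) (q : OpDatum E × Hist) : Prop :=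
  Summable fun n => ∑ t ∈ termLabels (domainGeometry R) (b13InnerData R) (R.carriers.scale X) X n,
    ‖term (labelsIndexing (domainGeometry R) (b13InnerData R)) (touchInc (domainGeometry R)) S.act (R.carriers.scale X)
      ⟨n, t⟩ q.1 q.2 X‖

/-- [folklore] BINDER (ii) of part (C) at the input `q` of `X`: absolute convergence of the ordered Ursell series of the activity of
record on every covering family of `X`. -/
def ClusAbsConv (X : R.carriers.Dom) (q : OpDatum E × Hist) : Prop :=
  ∀ K ∈ (domainGeometry R).clus X, Summable fun n =>
    UKabs (touchInc (domainGeometry R)) (actOf S X q) K (n + 1) / ((n + 1).factorial : ℝ)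

/-- [folklore] **ROUTE P2's RUN-B FUNCTIONAL IS THE OUTPUT OF RECORD.**  If `ρB g U` reads the activity of record at run B's input
point on the step catalogue of `X`, then under the two binders at that point `(domainGeometry R).EBre ρA ρB g U X =
B13StepOfRecord.outB S E₀ cB g U X` — part (C) + the holder's `representsB` (the recursion) + `step_Out` (`rfl`). -/
theorem EBre_eq_outB {g : ℕ → ℝ} {U : R.carriers.BgB} {X : R.carriers.Dom}
    (hρ : ∀ Z ∈ (domainGeometry R).level (R.carriers.scale X), ρB g U Z = actOf S X (inputB S E₀ cB g U X) Z)
    (hsum : LevelSummable S X (inputB S E₀ cB g U X)) (hK : ClusAbsConv S X (inputB S E₀ cB g U X)) :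
    (domainGeometry R).EBre ρA ρB g U X = outB S E₀ cB g U X := by
  rw [EBre_eq_re_out (domainGeometry R) (b13InnerData R) S.act ρA ρB (inputB S E₀ cB g U X).1 (inputB S E₀ cB g U X).2
    hρ hsum hK, representsB S E₀ cB Set.univ g (Set.mem_univ g) U X]
  rfl

/-- [folklore] **ROUTE P2's RUN-A FUNCTIONAL IS THE OUTPUT OF RECORD** (at transported backgrounds, on a window where the holder's
transport reading `TransportReads` holds and `ρA` is transported-read, `ClusterRepOfDomains.ActTransported`). -/
theorem EAre_eq_outA {W : Set (ℕ → ℝ)} (hT : (assembly S).TransportReads W) (hAT : DomainGeometry.ActTransported ρA)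
    {g : ℕ → ℝ} (hg : g ∈ W) {U : R.carriers.BgB} {X : R.carriers.Dom}
    (hρ : ∀ Z ∈ (domainGeometry R).level (R.carriers.scale X), ρA g U Z = actOf S X (inputA S E₀ cB g U X) Z)
    (hsum : LevelSummable S X (inputA S E₀ cB g U X)) (hK : ClusAbsConv S X (inputA S E₀ cB g U X)) :
    (domainGeometry R).EAre ρA ρB g (R.carriers.transport U) X = outA S E₀ cB g (R.carriers.transport U) X := by
  rw [DomainGeometry.EAre_transport (domainGeometry R) hAT, outA_clusterRep_eq_out (domainGeometry R) (b13InnerData R) S.act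
    ρA ρB (inputA S E₀ cB g U X).1 (inputA S E₀ cB g U X).2 hρ hsum hK,
    representsA S E₀ cB hT g hg U X]
  rfl

/-! ## §3 NE5 for the two routes' functionals is ONE statement on the window -/

/-- [folklore] **NE5 TRANSFERS FROM ROUTE P2's FUNCTIONALS TO THE OUTPUTS OF RECORD** on any window where they agree (the
agreement being `EBre_eq_outB`∕`EAre_eq_outA` pointwise). -/
theorem ne5_record_of_ne5_re {W : Set (ℕ → ℝ)} {κ θ C₅ : ℝ}
    (hA : ∀ g ∈ W, ∀ (U : R.carriers.BgB) (X : R.carriers.Dom),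
      (domainGeometry R).EAre ρA ρB g (R.carriers.transport U) X = outA S E₀ cB g (R.carriers.transport U) X)
    (hB : ∀ g ∈ W, ∀ (U : R.carriers.BgB) (X : R.carriers.Dom), (domainGeometry R).EBre ρA ρB g U X = outB S E₀ cB g U X)
    (h : NE5 ((domainGeometry R).EAre ρA ρB) ((domainGeometry R).EBre ρA ρB) W κ θ C₅) :
    NE5 (outA S E₀ cB) (outB S E₀ cB) W κ θ C₅ :=
  ne5_congr (fun g hg U X => (hA g hg U X).symm) (fun g hg U X => (hB g hg U X).symm) h

/-- [folklore] … and back. -/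
theorem ne5_re_of_ne5_record {W : Set (ℕ → ℝ)} {κ θ C₅ : ℝ}
    (hA : ∀ g ∈ W, ∀ (U : R.carriers.BgB) (X : R.carriers.Dom),
      (domainGeometry R).EAre ρA ρB g (R.carriers.transport U) X = outA S E₀ cB g (R.carriers.transport U) X)
    (hB : ∀ g ∈ W, ∀ (U : R.carriers.BgB) (X : R.carriers.Dom), (domainGeometry R).EBre ρA ρB g U X = outB S E₀ cB g U X)
    (h : NE5 (outA S E₀ cB) (outB S E₀ cB) W κ θ C₅) :
    NE5 ((domainGeometry R).EAre ρA ρB) ((domainGeometry R).EBre ρA ρB) W κ θ C₅ :=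
  ne5_congr hA hB h

/-- [folklore] **THE TWO NE5 ROUTES PROVE ONE STATEMENT** (assembled form): if on the window `W` both activity families read the
activity of record at the runs' input points of record and the two convergence binders hold there (plus the transport readings for
run A), then `NE5` for route P2's `(EAre, EBre)` and `NE5` for the outputs of record `(outA, outB)` are equivalent. -/
theorem ne5_re_iff_ne5_record {W : Set (ℕ → ℝ)} {κ θ C₅ : ℝ} (hT : (assembly S).TransportReads W)
    (hAT : DomainGeometry.ActTransported ρA)
    (hρA : ∀ g ∈ W, ∀ (U : R.carriers.BgB) (X : R.carriers.Dom), ∀ Z ∈ (domainGeometry R).level (R.carriers.scale X),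
      ρA g U Z = actOf S X (inputA S E₀ cB g U X) Z)
    (hρB : ∀ g ∈ W, ∀ (U : R.carriers.BgB) (X : R.carriers.Dom), ∀ Z ∈ (domainGeometry R).level (R.carriers.scale X),
      ρB g U Z = actOf S X (inputB S E₀ cB g U X) Z)
    (hsumA : ∀ g ∈ W, ∀ (U : R.carriers.BgB) (X : R.carriers.Dom), LevelSummable S X (inputA S E₀ cB g U X))
    (hKA : ∀ g ∈ W, ∀ (U : R.carriers.BgB) (X : R.carriers.Dom), ClusAbsConv S X (inputA S E₀ cB g U X))
    (hsumB : ∀ g ∈ W, ∀ (U : R.carriers.BgB) (X : R.carriers.Dom), LevelSummable S X (inputB S E₀ cB g U X))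
    (hKB : ∀ g ∈ W, ∀ (U : R.carriers.BgB) (X : R.carriers.Dom), ClusAbsConv S X (inputB S E₀ cB g U X)) :
    NE5 ((domainGeometry R).EAre ρA ρB) ((domainGeometry R).EBre ρA ρB) W κ θ C₅ ↔ NE5 (outA S E₀ cB) (outB S E₀ cB) W κ θ C₅ :=
  (ne5_iff_of_agree
    (fun g hg U X => EAre_eq_outA S E₀ cB ρA ρB hT hAT hg (hρA g hg U X) (hsumA g hg U X) (hKA g hg U X))
    (fun g hg U X => EBre_eq_outB S E₀ cB ρA ρB (hρB g hg U X) (hsumB g hg U X) (hKB g hg U X))).symm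

end Record

end Summit.QuantumFields.BalabanUV.T4Continuum.B13OutKPFormRecord

end
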